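import Literature.NumberTheory.Transcendental.HypersurfaceGridSlices
import HarnessLib

/-!
# The grid lemma: a real hypersurface meets few cubes of a cubical grid

**Grid lemma** (`exists_card_cubes_zeroSet_le`).  For all `m, d` there is a constant `c` such that
for every nonzero `P ∈ ℝ[x_0, …, x_m]` of total degree `≤ d`, every cubical grid in `ℝ^{m+1}` with `n`
subdivisions per axis (any origin, any mesh `h > 0`), the zero set `Z(P)` meets at most `c · n^m` of
the `n^{m+1}` closed grid cubes.

This is the effective-convergence input for the lattice-count approximation of volumes of bounded
semialgebraic sets (Yoshinaga, arXiv:0805.0349, Lemma 29, where it is derived from the finiteness of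
the `(ℓ-1)`-dimensional Minkowski content of `∂D` via Hironaka's uniformization; Krantz–Parks 1999).
The proof given here is elementary: induction on the dimension, viewing `P` as `G ∈ A[T]` in the
coordinate `t = x_0` (`HypersurfaceGridSlices.lean`), and an inner induction on `deg_T G`.  A cube met by
`Z(G)` either (A) has a zero of `G` on its bottom or top face — counted through the slices `G(a_j, ·)`
by the outer induction hypothesis (`mul_card_faceZeros_le`); or (B) `G` has opposite nonzero signs on
the two faces — then the vertical edge through the corner carries a root of `G` strictly between the
two levels, and each of the `n^m` columns carries at most `d` such roots (`card_columnRoots_le`); or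
(C) `G` has the same nonzero sign on both faces and an interior zero — then `∂G/∂T` vanishes inside the
cube (interior extremum on the vertical segment), and `∂G/∂T` has smaller `T`-degree
(`zero_cover`).  The dimension-zero statement is formulated as `n · #cubes ≤ c · n^m` for
`P ∈ ℝ[x_0,…,x_{m-1}]` so that the induction starts at `m = 0`.

## References

* M. Yoshinaga, *Periods and elementary real numbers*, arXiv:0805.0349 (2008), §3.4 and Lemma 29.
* S. G. Krantz, H. R. Parks, *The geometry of domains in space*, Birkhäuser (1999) (Minkowski
  content; the source of Yoshinaga's Prop. 28, not needed here).
-/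

noncomputable section

open Polynomial Finset

namespace Literature.NumberTheory.Transcendental

variable {m : ℕ}

/-! ### The covering A ∪ B ∪ C of the cubes met by the zero set -/

/-- A polynomial of `T`-degree `0` is constant along vertical lines. [folklore] -/
theorem eval_map_eq_of_natDegree_eq_zero {A : Type*} [CommSemiring A] (G : Polynomial A)
    (hG : G.natDegree = 0) (f : A →+* ℝ) (s s' : ℝ) : (G.map f).eval s = (G.map f).eval s' := by
  rw [Polynomial.eq_C_of_natDegree_eq_zero hG]
  simp

/-- **Covering of the cubes met by `Z(G)`.**  If `G` vanishes at a point `Fin.cons t y` of the cube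
(level `j`, base cube of `y`), then (A) `G` vanishes at a point of the bottom or of the top face, or
(B) the vertical-line polynomial through the corner of the base cube is nonzero and has a root strictly
between the two levels, or (C) `∂G/∂T` vanishes at a point of the cube. [folklore] -/
theorem zero_cover (G : Polynomial (MvPolynomial (Fin m) ℝ)) (t₀ : ℝ) (y₀ : Fin m → ℝ) {h : ℝ}
    (hh : 0 < h) (j : ℕ) (k : Fin m → ℕ)
    (hZ : ∃ t y, (t₀ + h * j ≤ t ∧ t ≤ t₀ + h * (j + 1)) ∧ y ∈ gridCube y₀ h k ∧
      (G.map (MvPolynomial.eval y)).eval t = 0) :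
    (∃ y ∈ gridCube y₀ h k, (G.map (MvPolynomial.eval y)).eval (t₀ + h * j) = 0 ∨
        (G.map (MvPolynomial.eval y)).eval (t₀ + h * (j + 1)) = 0) ∨
      (G.map (MvPolynomial.eval fun i => y₀ i + h * k i) ≠ 0 ∧
        ∃ t ∈ Set.Ioo (t₀ + h * j) (t₀ + h * (j + 1)),
          (G.map (MvPolynomial.eval fun i => y₀ i + h * k i)).IsRoot t) ∨
      (∃ t y, (t₀ + h * j ≤ t ∧ t ≤ t₀ + h * (j + 1)) ∧ y ∈ gridCube y₀ h k ∧
        ((derivative G).map (MvPolynomial.eval y)).eval t = 0) := by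
  by_cases hA : ∃ y ∈ gridCube y₀ h k, (G.map (MvPolynomial.eval y)).eval (t₀ + h * j) = 0 ∨
      (G.map (MvPolynomial.eval y)).eval (t₀ + h * (j + 1)) = 0
  · exact Or.inl hA
  right
  push Not at hA
  obtain ⟨t, y, ⟨ht1, ht2⟩, hy, hroot⟩ := hZ
  -- notation
  set a : ℝ := t₀ + h * j with ha
  set b : ℝ := t₀ + h * (j + 1) with hb
  have hab : a < b := by simp only [ha, hb]; nlinarith
  set c : Fin m → ℝ := fun i => y₀ i + h * k i with hc
  have hcmem : c ∈ gridCube y₀ h k := corner_mem_gridCube y₀ hh.le k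
  set sb : MvPolynomial (Fin m) ℝ := G.eval (MvPolynomial.C a) with hsb
  set st : MvPolynomial (Fin m) ℝ := G.eval (MvPolynomial.C b) with hst
  have hsb0 : ∀ w ∈ gridCube y₀ h k, MvPolynomial.eval w sb ≠ 0 := fun w hw => by
    rw [hsb, eval_eval_C]; exact (hA w hw).1
  have hst0 : ∀ w ∈ gridCube y₀ h k, MvPolynomial.eval w st ≠ 0 := fun w hw => by
    rw [hst, eval_eval_C]; exact (hA w hw).2
  -- the zero is strictly between the levels
  have hta : t ≠ a := fun e => (hA y hy).1 (by rw [← e]; exact hroot)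
  have htb : t ≠ b := fun e => (hA y hy).2 (by rw [← e]; exact hroot)
  have ht : t ∈ Set.Ioo a b := ⟨lt_of_le_of_ne ht1 (Ne.symm hta), lt_of_le_of_ne ht2 htb⟩
  -- sign transport between `y` and the corner `c`
  have hiff_b : (0 < (G.map (MvPolynomial.eval y)).eval a ↔
      0 < (G.map (MvPolynomial.eval c)).eval a) := by
    rw [← eval_eval_C, ← eval_eval_C]
    exact eval_pos_iff_of_forall_ne_zero sb hsb0 hy hcmem
  have hiff_t : (0 < (G.map (MvPolynomial.eval y)).eval b ↔
      0 < (G.map (MvPolynomial.eval c)).eval b) := by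
    rw [← eval_eval_C, ← eval_eval_C]
    exact eval_pos_iff_of_forall_ne_zero st hst0 hy hcmem
  have hya : (G.map (MvPolynomial.eval y)).eval a ≠ 0 := (hA y hy).1
  have hyb : (G.map (MvPolynomial.eval y)).eval b ≠ 0 := (hA y hy).2
  have hca : (G.map (MvPolynomial.eval c)).eval a ≠ 0 := (hA c hcmem).1
  have hcb : (G.map (MvPolynomial.eval c)).eval b ≠ 0 := (hA c hcmem).2
  by_cases hsame : (0 < (G.map (MvPolynomial.eval c)).eval a ↔
      0 < (G.map (MvPolynomial.eval c)).eval b)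
  · -- case (C): same sign on both faces along the vertical line through `y`
    right
    have hysame : (0 < (G.map (MvPolynomial.eval y)).eval a ↔
        0 < (G.map (MvPolynomial.eval y)).eval b) := hiff_b.trans (hsame.trans hiff_t.symm)
    have hprod : 0 < (G.map (MvPolynomial.eval y)).eval a * (G.map (MvPolynomial.eval y)).eval b := by
      by_cases hpos : 0 < (G.map (MvPolynomial.eval y)).eval a
      · exact mul_pos hpos (hysame.1 hpos)
      · have h1 : (G.map (MvPolynomial.eval y)).eval a < 0 := lt_of_le_of_ne (not_lt.1 hpos) hya
        have h2 : (G.map (MvPolynomial.eval y)).eval b < 0 :=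
          lt_of_le_of_ne (not_lt.1 fun h' => hpos (hysame.2 h')) hyb
        exact mul_pos_of_neg_of_neg h1 h2
    obtain ⟨s, hs, hs'⟩ :=
      exists_isRoot_derivative_of_sign (G.map (MvPolynomial.eval y)) hab hprod ht hroot
    rw [Polynomial.derivative_map] at hs'
    exact ⟨s, y, ⟨hs.1.le, hs.2.le⟩, hy, hs'⟩
  · -- case (B): opposite signs at the corner; a root on the corner's vertical edge
    left
    have hg0 : G.map (MvPolynomial.eval c) ≠ 0 := fun e => hca (by rw [e, Polynomial.eval_zero])
    refine ⟨hg0, ?_⟩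
    have hcont : ContinuousOn (fun s => (G.map (MvPolynomial.eval c)).eval s) (Set.Icc a b) :=
      (G.map (MvPolynomial.eval c)).differentiable.continuous.continuousOn
    by_cases hpos : 0 < (G.map (MvPolynomial.eval c)).eval a
    · have hneg : (G.map (MvPolynomial.eval c)).eval b < 0 :=
        lt_of_le_of_ne (not_lt.1 fun h' => hsame ⟨fun _ => h', fun _ => hpos⟩) hcb
      have hmem : (0 : ℝ) ∈ Set.Icc ((G.map (MvPolynomial.eval c)).eval b)
          ((G.map (MvPolynomial.eval c)).eval a) := ⟨hneg.le, hpos.le⟩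
      obtain ⟨s, hs, hs0⟩ := intermediate_value_Icc' hab.le hcont hmem
      have hsa : s ≠ a := fun e => hca (by rw [← e]; exact hs0)
      have hsb' : s ≠ b := fun e => hcb (by rw [← e]; exact hs0)
      exact ⟨s, ⟨lt_of_le_of_ne hs.1 (Ne.symm hsa), lt_of_le_of_ne hs.2 hsb'⟩, hs0⟩
    · have hneg : (G.map (MvPolynomial.eval c)).eval a < 0 := lt_of_le_of_ne (not_lt.1 hpos) hca
      have hpos' : 0 < (G.map (MvPolynomial.eval c)).eval b := by
        by_contra h'
        exact hsame ⟨fun h1 => absurd h1 hpos, fun h2 => absurd h2 h'⟩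
      have hmem : (0 : ℝ) ∈ Set.Icc ((G.map (MvPolynomial.eval c)).eval a)
          ((G.map (MvPolynomial.eval c)).eval b) := ⟨hneg.le, hpos'.le⟩
      obtain ⟨s, hs, hs0⟩ := intermediate_value_Icc hab.le hcont hmem
      have hsa : s ≠ a := fun e => hca (by rw [← e]; exact hs0)
      have hsb' : s ≠ b := fun e => hcb (by rw [← e]; exact hs0)
      exact ⟨s, ⟨lt_of_le_of_ne hs.1 (Ne.symm hsa), lt_of_le_of_ne hs.2 hsb'⟩, hs0⟩

/-! ### The inductive step: inner induction on the `T`-degree -/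

open Classical in
/-- **Inductive step of the grid lemma.**  Under the dimension-`m` hypothesis (every nonzero
`Q ∈ ℝ[y_1,…,y_m]` of total degree `≤ d` vanishes on at most `c n^m / n` base cubes), a nonzero
`G ∈ A[T]` with coefficients of total degree `≤ d` and `deg_T G ≤ e ≤ d` vanishes on at most
`(e + 1)(4c + 3d) n^{m+1} / n` cubes (level `j`, base cube `k'`) of any grid.  Induction on `e` using
`zero_cover`, `mul_card_faceZeros_le`, `card_columnRoots_le`. [folklore] -/
theorem mul_card_zeros_le_step {c d : ℕ}
    (IH : ∀ Q : MvPolynomial (Fin m) ℝ, Q ≠ 0 → Q.totalDegree ≤ d →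
      ∀ (n : ℕ) (y₀ : Fin m → ℝ) (h : ℝ), 0 < h →
        n * (Finset.univ.filter fun k' : Fin m → Fin n =>
          ∃ y ∈ gridCube y₀ h (fun i => (k' i : ℕ)), MvPolynomial.eval y Q = 0).card ≤ c * n ^ m) :
    ∀ (e : ℕ) (G : Polynomial (MvPolynomial (Fin m) ℝ)), G ≠ 0 →
      (∀ i, (G.coeff i).totalDegree ≤ d) → G.natDegree ≤ e → e ≤ d →
      ∀ (n : ℕ) (t₀ : ℝ) (y₀ : Fin m → ℝ) (h : ℝ), 0 < h →
        n * (Finset.univ.filter fun p : Fin n × (Fin m → Fin n) =>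
          ∃ t y, (t₀ + h * (p.1 : ℕ) ≤ t ∧ t ≤ t₀ + h * ((p.1 : ℕ) + 1)) ∧
            y ∈ gridCube y₀ h (fun i => (p.2 i : ℕ)) ∧
              (G.map (MvPolynomial.eval y)).eval t = 0).card ≤
          (e + 1) * (4 * c + 3 * d) * n ^ (m + 1) := by
  -- the degree-zero case, used twice
  have hzero : ∀ (e : ℕ) (G : Polynomial (MvPolynomial (Fin m) ℝ)), G ≠ 0 →
      (∀ i, (G.coeff i).totalDegree ≤ d) → G.natDegree = 0 →
      ∀ (n : ℕ) (t₀ : ℝ) (y₀ : Fin m → ℝ) (h : ℝ), 0 < h →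
        n * (Finset.univ.filter fun p : Fin n × (Fin m → Fin n) =>
          ∃ t y, (t₀ + h * (p.1 : ℕ) ≤ t ∧ t ≤ t₀ + h * ((p.1 : ℕ) + 1)) ∧
            y ∈ gridCube y₀ h (fun i => (p.2 i : ℕ)) ∧
              (G.map (MvPolynomial.eval y)).eval t = 0).card ≤
          (e + 1) * (4 * c + 3 * d) * n ^ (m + 1) := by
    intro e G hG0 hG hdeg n t₀ y₀ h hh
    have hsub : (Finset.univ.filter fun p : Fin n × (Fin m → Fin n) =>
          ∃ t y, (t₀ + h * (p.1 : ℕ) ≤ t ∧ t ≤ t₀ + h * ((p.1 : ℕ) + 1)) ∧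
            y ∈ gridCube y₀ h (fun i => (p.2 i : ℕ)) ∧
              (G.map (MvPolynomial.eval y)).eval t = 0) ⊆
        (Finset.univ.filter fun p : Fin n × (Fin m → Fin n) =>
          ∃ y ∈ gridCube y₀ h (fun i => (p.2 i : ℕ)),
            (G.map (MvPolynomial.eval y)).eval (t₀ + h * (p.1 : ℕ)) = 0 ∨
              (G.map (MvPolynomial.eval y)).eval (t₀ + h * ((p.1 : ℕ) + 1)) = 0) := by
      intro p hp
      simp only [Finset.mem_filter, Finset.mem_univ, true_and] at hp ⊢
      obtain ⟨t, y, -, hy, hroot⟩ := hp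
      exact ⟨y, hy, Or.inl (by rw [eval_map_eq_of_natDegree_eq_zero G hdeg _ _ t]; exact hroot)⟩
    calc _ ≤ n * _ := Nat.mul_le_mul_left _ (Finset.card_le_card hsub)
      _ ≤ (4 * c + 2 * d) * n ^ (m + 1) :=
          mul_card_faceZeros_le IH G hG0 hG (hdeg.le.trans (Nat.zero_le d)) n t₀ y₀ hh
      _ ≤ (e + 1) * (4 * c + 3 * d) * n ^ (m + 1) := by
          apply Nat.mul_le_mul_right; nlinarith
  intro e
  induction e with
  | zero =>
      intro G hG0 hG hGe _ n t₀ y₀ h hh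
      exact hzero 0 G hG0 hG (Nat.le_zero.1 hGe) n t₀ y₀ h hh
  | succ e ihe =>
      intro G hG0 hG hGe hed n t₀ y₀ h hh
      by_cases hdeg : G.natDegree = 0
      · exact hzero (e + 1) G hG0 hG hdeg n t₀ y₀ h hh
      -- positive `T`-degree: the derivative is a nonzero polynomial of smaller degree
      have hG'0 : derivative G ≠ 0 := fun h0 => hdeg (Polynomial.derivative_eq_zero.1 h0)
      have hG'e : (derivative G).natDegree ≤ e :=
        (Polynomial.natDegree_derivative_le G).trans (by omega)
      have hC := ihe (derivative G) hG'0 (totalDegree_coeff_derivative_le G hG) hG'e (by omega)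
        n t₀ y₀ h hh
      have hAface := mul_card_faceZeros_le IH G hG0 hG (hGe.trans hed) n t₀ y₀ hh
      have hBcol := card_columnRoots_le G (hGe.trans hed) n t₀ y₀ hh
      -- the covering
      have hsub : (Finset.univ.filter fun p : Fin n × (Fin m → Fin n) =>
            ∃ t y, (t₀ + h * (p.1 : ℕ) ≤ t ∧ t ≤ t₀ + h * ((p.1 : ℕ) + 1)) ∧
              y ∈ gridCube y₀ h (fun i => (p.2 i : ℕ)) ∧
                (G.map (MvPolynomial.eval y)).eval t = 0) ⊆
          (Finset.univ.filter fun p : Fin n × (Fin m → Fin n) =>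
            ∃ y ∈ gridCube y₀ h (fun i => (p.2 i : ℕ)),
              (G.map (MvPolynomial.eval y)).eval (t₀ + h * (p.1 : ℕ)) = 0 ∨
                (G.map (MvPolynomial.eval y)).eval (t₀ + h * ((p.1 : ℕ) + 1)) = 0) ∪
          ((Finset.univ.filter fun p : Fin n × (Fin m → Fin n) =>
            G.map (MvPolynomial.eval fun i => y₀ i + h * (p.2 i : ℕ)) ≠ 0 ∧
              ∃ t ∈ Set.Ioo (t₀ + h * (p.1 : ℕ)) (t₀ + h * ((p.1 : ℕ) + 1)),
                (G.map (MvPolynomial.eval fun i => y₀ i + h * (p.2 i : ℕ))).IsRoot t) ∪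
          (Finset.univ.filter fun p : Fin n × (Fin m → Fin n) =>
            ∃ t y, (t₀ + h * (p.1 : ℕ) ≤ t ∧ t ≤ t₀ + h * ((p.1 : ℕ) + 1)) ∧
              y ∈ gridCube y₀ h (fun i => (p.2 i : ℕ)) ∧
                ((derivative G).map (MvPolynomial.eval y)).eval t = 0)) := by
        intro p hp
        simp only [Finset.mem_union, Finset.mem_filter, Finset.mem_univ, true_and] at hp ⊢
        exact zero_cover G t₀ y₀ hh (p.1 : ℕ) (fun i => (p.2 i : ℕ)) hp
      calc _ ≤ n * _ := Nat.mul_le_mul_left _ (Finset.card_le_card hsub)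
        _ ≤ n * (_ + (_ + _)) :=
            Nat.mul_le_mul_left _ ((card_union_le _ _).trans (add_le_add le_rfl (card_union_le _ _)))
        _ = n * _ + (n * _ + n * _) := by rw [mul_add, mul_add]
        _ ≤ (4 * c + 2 * d) * n ^ (m + 1) + (n * (d * n ^ m) + (e + 1) * (4 * c + 3 * d) * n ^ (m + 1)) :=
            add_le_add hAface (add_le_add (Nat.mul_le_mul_left _ hBcol) hC)
        _ = (e + 1 + 1) * (4 * c + 3 * d) * n ^ (m + 1) := by ring

/-! ### The grid lemma -/

/-- Coercions of `Fin.cons`-indices: the `ℕ`-valued multi-index of `Fin.cons j k'` is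
`Fin.cons ↑j ↑k'`. [folklore] -/
theorem natCast_cons {n : ℕ} (j : Fin n) (k' : Fin m → Fin n) :
    (fun i => ((Fin.cons j k' : Fin (m + 1) → Fin n) i : ℕ)) =
      Fin.cons (j : ℕ) (fun i => (k' i : ℕ)) := by
  funext i
  refine Fin.cases ?_ (fun i => ?_) i <;> simp

open Classical in
/-- **Grid lemma, multiplicative form (all dimensions).**  For all `m, d` there is `c` such that every
nonzero `P ∈ ℝ[x_0,…,x_{m-1}]` of total degree `≤ d` vanishes on at most `c n^m / n` of the closed
cubes of any cubical grid with `n` subdivisions per axis: `n · #{cubes met by Z(P)} ≤ c · n^m`.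
Induction on `m` through `mul_card_zeros_le_step`. [folklore] -/
theorem exists_mul_card_cubes_zeroSet_le (m d : ℕ) :
    ∃ c : ℕ, ∀ P : MvPolynomial (Fin m) ℝ, P ≠ 0 → P.totalDegree ≤ d →
      ∀ (n : ℕ) (x₀ : Fin m → ℝ) (h : ℝ), 0 < h →
        n * (Finset.univ.filter fun k : Fin m → Fin n =>
          ∃ x ∈ gridCube x₀ h (fun i => (k i : ℕ)), MvPolynomial.eval x P = 0).card ≤ c * n ^ m := by
  induction m with
  | zero =>
      refine ⟨0, fun P hP _ n x₀ h _ => ?_⟩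
      obtain ⟨r, rfl⟩ := MvPolynomial.C_surjective (Fin 0) P
      have hr : r ≠ 0 := fun e => hP (by rw [e, map_zero])
      simp only [MvPolynomial.eval_C, zero_mul, nonpos_iff_eq_zero, mul_eq_zero,
        Finset.card_eq_zero, Finset.filter_eq_empty_iff]
      exact Or.inr fun k _ ⟨x, _, hx⟩ => hr hx
  | succ m ihm =>
      obtain ⟨c, hc⟩ := ihm
      refine ⟨(d + 1) * (4 * c + 3 * d), fun P hP hPd n x₀ h hh => ?_⟩
      set G := MvPolynomial.finSuccEquiv ℝ m P with hGdef
      have hG0 : G ≠ 0 := fun e =>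
        hP ((MvPolynomial.finSuccEquiv ℝ m).injective (by rw [← hGdef, e, map_zero]))
      have hcoef : ∀ i, (G.coeff i).totalDegree ≤ d := fun i =>
        (totalDegree_coeff_finSuccEquiv_le P i).trans hPd
      have hGd : G.natDegree ≤ d := by
        rw [hGdef, MvPolynomial.natDegree_finSuccEquiv]
        exact (MvPolynomial.degreeOf_le_totalDegree P 0).trans hPd
      have step := mul_card_zeros_le_step hc d G hG0 hcoef hGd le_rfl n (x₀ 0) (Fin.tail x₀) h hh
      -- identify the two counts through `Fin.consEquiv`
      have hcard : (Finset.univ.filter fun k : Fin (m + 1) → Fin n =>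
            ∃ x ∈ gridCube x₀ h (fun i => (k i : ℕ)), MvPolynomial.eval x P = 0).card =
          (Finset.univ.filter fun p : Fin n × (Fin m → Fin n) =>
            ∃ t y, (x₀ 0 + h * (p.1 : ℕ) ≤ t ∧ t ≤ x₀ 0 + h * ((p.1 : ℕ) + 1)) ∧
              y ∈ gridCube (Fin.tail x₀) h (fun i => (p.2 i : ℕ)) ∧
                (G.map (MvPolynomial.eval y)).eval t = 0).card := by
        symm
        refine Finset.card_equiv (Fin.consEquiv fun _ => Fin n) (fun p => ?_)
        obtain ⟨j, k'⟩ := p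
        simp only [Finset.mem_filter, Finset.mem_univ, true_and, Fin.consEquiv_apply]
        rw [natCast_cons]
        constructor
        · rintro ⟨t, y, ht, hy, hroot⟩
          refine ⟨Fin.cons t y, ?_, ?_⟩
          · rw [← Fin.cons_self_tail x₀]
            exact cons_mem_gridCube_cons_iff.2 ⟨ht, hy⟩
          · rw [MvPolynomial.eval_eq_eval_mv_eval']; exact hroot
        · rintro ⟨x, hx, hroot⟩
          rw [← Fin.cons_self_tail x₀, mem_gridCube_cons_iff] at hx
          refine ⟨x 0, Fin.tail x, hx.1, hx.2, ?_⟩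
          rw [← Fin.cons_self_tail x, MvPolynomial.eval_eq_eval_mv_eval'] at hroot
          simpa using hroot
      rw [hcard]
      exact step

open Classical in
/-- **Grid lemma** (counting form, dimension `m + 1`).  For all `m, d` there is a constant `c` such
that for every nonzero `P ∈ ℝ[x_0, …, x_m]` of total degree `≤ d` and every cubical grid in `ℝ^{m+1}`
with `n` subdivisions per axis, origin `x₀` and mesh `h > 0`, the zero set of `P` meets at most
`c · n^m` of the `n^{m+1}` closed grid cubes.  (Replaces the Minkowski-content estimate of Yoshinaga
2008, Lemma 29.) [folklore] -/
theorem exists_card_cubes_zeroSet_le (m d : ℕ) :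
    ∃ c : ℕ, ∀ P : MvPolynomial (Fin (m + 1)) ℝ, P ≠ 0 → P.totalDegree ≤ d →
      ∀ (n : ℕ) (x₀ : Fin (m + 1) → ℝ) (h : ℝ), 0 < h →
        (Finset.univ.filter fun k : Fin (m + 1) → Fin n =>
          ∃ x ∈ gridCube x₀ h (fun i => (k i : ℕ)), MvPolynomial.eval x P = 0).card ≤ c * n ^ m := by
  obtain ⟨c, hc⟩ := exists_mul_card_cubes_zeroSet_le (m + 1) d
  refine ⟨c, fun P hP hPd n x₀ h hh => ?_⟩
  rcases Nat.eq_zero_or_pos n with rfl | hn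
  · simp
  have := hc P hP hPd n x₀ h hh
  rw [pow_succ, ← mul_assoc, mul_comm (c * n ^ m) n] at this
  exact Nat.le_of_mul_le_mul_left this hn

end Literature.NumberTheory.Transcendental
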